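import Mathlib
import Summits.ValiantsHypothesis.ValiantsHypothesis.Theorems.KPlusLogSqLawTropicalCycleMonotone
import Summits.ValiantsHypothesis.ValiantsHypothesis.Theorems.LacunarySymmetroidMatrixDescartesCensusTropicalKLawSlopes

/-!
# Route «KPlusLogSqLaw», crux `TropicalB` (stmt-ValiantsHypothesis-19771) — FORBIDDEN HISTOGRAM PATTERNS of the `m = 3` row and
# «(3,5) is not counting-tight» on the convex and concave exponent regions: `T(3,5; d) ≤ 33` there

HONEST FRAMING.  Helper toward the crux `Summit.ValiantsHypothesis.ValiantsHypothesis.Theses.KPlusLogSqLaw.TropicalB` (ledger item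
`stmt-ValiantsHypothesis-19771`; cell `pub-symmetroid`, seat val-sym-trop-p4 g5, 2026-08-27; `--supports … --as helper`).  A census /
structure file about `3 × 3` designs; nothing here bears on `TropicalB` in its window, `WeakLifting`, the doors, `MatrixDescartes`
(stmt-ValiantsHypothesis-18050) or VP ≠ VNP.  It is the KERNEL part of the seat's located result «T(3,5) ≤ 33 for every exponent vector»
(memo HOME/val-sym-trop-p4/g5/THREE-FIVE-g5.md: an exact 1520-cell computation from the pairwise exchange law); here the two exponent
regions whose unsatisfiable core needs ONLY the order of the classes are done in the kernel.

THE ONE LAW USED.  Cyclewise exchange (`KPlusLogSqLaw.sum_d_lt_of_isDominant_invariant`, conjb-2 / val-sym-trop-p4): if `P` is the unique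
optimum at `θ` and `R` at `θ' > θ`, then on every column set `T` invariant under `σ_P⁻¹σ_R` where the two terms differ, the exponent sum of
`R` strictly exceeds that of `P`.  Hence (`domB_sound`) a pair `(P earlier, R later)` is IMPOSSIBLE as soon as, on some such `T`, the classes
of `R` are dominated by those of `P` after a rematching `π` of `T` (`R`-class of `b` ≤ `P`-class of `π b`) — a condition on class INDICES
only, valid for every exponent vector increasing in the index (`domB`, a Boolean test; abstract classes `Fin 5` embedded by a monotone
injective `ι : Fin 5 → Fin K`).

FORBIDDEN PATTERNS (`decide` on the Boolean search `coreU1` / `coreU2`, ≈ 10⁴ pair tests; then `no_pattern_U1` / `no_pattern_U2`):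
* U1 (convex side): no dominant chain contains, in this order, terms with class multisets `{1,1,1} , {0,2,2} , {2,2,2} , {0,1,3} , {0,0,4}`;
* U2 (concave side): no dominant chain contains, in this order, terms with class multisets `{0,0,4} , {0,2,2} , {0,1,3} , {1,1,1}`
(abstract classes `0 < 1 < 2 < 3 < 4` = any five classes on which `d` is increasing).  U1 by hand: parities force the permutations of the
`111, 222, 013, 004` terms into one coset of `A₃`, and the cycle types required by the pairs `022–013`, `022–004`, `013–004` then collide.

CONSEQUENCE (`three_five_le_of_convex`, `three_five_le_of_concave`): for `K = 5` and strictly increasing `d` with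
`3d₁ < d₀+2d₂`, `3d₂ < d₀+d₁+d₃`, `d₁+d₃ < d₀+d₄` (CONVEX region — every super-increasing / lexicographic design) resp.
`2d₀+d₄ < d₀+2d₂ < d₀+d₁+d₃ < 3d₁` (CONCAVE region), every sign-alternating dominant chain has `n ≤ 33` sign changes: a chain with 34 would
carry 35 pairwise distinct class multisets (`TropicalCensus.slope_lt_of_dominant`), i.e. ALL of them, hence the pattern in slope order.
So the `(3,5)` row (`27 ≤ T(3,5) ≤ 34 = C(7,3) − 1` of record) is NOT counting-tight on these regions; the remaining (near-arithmetic)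
exponent cells are covered by the located computation only (order-type-specific cores of 4–8 histograms).  [this cell]
-/

-- `Summit.ValiantsHypothesis.ValiantsHypothesis.…` repeats a component by the D-0017 layout
-- (single-conjunct summit), which the `dupNamespace` linter flags; the name is mandated.
set_option linter.dupNamespace false
set_option autoImplicit false

namespace Summit.ValiantsHypothesis.ValiantsHypothesis.Theorems.KPlusLogSqLaw

open Summit.ValiantsHypothesis.ValiantsHypothesis.Theorems.MatrixDescartes.Negative
open Summit.ValiantsHypothesis.ValiantsHypothesis.Theorems.LacunarySymmetroidMatrixDescartes.TropicalCensus
open Finset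

namespace ForbiddenPatterns

/-! ## 1. The Boolean domination test and its soundness -/

/-- the six permutations of `Fin 3`. -/
def S3List : List (Equiv.Perm (Fin 3)) :=
  [1, Equiv.swap 0 1, Equiv.swap 0 2, Equiv.swap 1 2, Equiv.swap 0 1 * Equiv.swap 1 2, Equiv.swap 1 2 * Equiv.swap 0 1]

/-- `S3List` lists every permutation of `Fin 3`. -/
theorem mem_S3List (σ : Equiv.Perm (Fin 3)) : σ ∈ S3List := by
  revert σ
  decide

/-- the seven nonempty column subsets of `Fin 3`, as indicator functions. -/
def maskList : List (Fin 3 → Bool) :=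
  [![true, false, false], ![false, true, false], ![false, false, true], ![true, true, false], ![true, false, true],
    ![false, true, true], ![true, true, true]]

/-- **Boolean domination test** for an (earlier, later) pair of abstract terms (permutation, class indices in `Fin 5`): some column set
`T` invariant under `P.1⁻¹ R.1` on which the terms differ, and a rematching `π` of `T` with `R`-class of `b` ≤ `P`-class of `π b` on `T`. -/
def domB (P R : Equiv.Perm (Fin 3) × (Fin 3 → Fin 5)) : Bool :=
  maskList.any fun T =>
    decide (∀ b, T ((P.1⁻¹ * R.1) b) = T b) && decide (∃ b, T b = true ∧ (P.1 b ≠ R.1 b ∨ P.2 b ≠ R.2 b)) &&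
      S3List.any fun π => decide (∀ b, T b = true → T (π b) = true) && decide (∀ b, T b = true → R.2 b ≤ P.2 (π b))

/-- **Soundness of the domination test.**  If `domB P R` holds, then in NO design whose exponents are monotone along an injective class
embedding `ι : Fin 5 → Fin K` can `(P.1, ι ∘ P.2)` be the unique optimum at some `θ` and `(R.1, ι ∘ R.2)` at a later `θ'`.
(Cyclewise exchange gives `Σ_T d(P) < Σ_T d(R)`; domination and monotonicity give `Σ_T d(R) ≤ Σ_T d(P ∘ π) = Σ_T d(P)`.) -/
theorem domB_sound {K : ℕ} (d : Fin K → ℕ) (v ε : Fin 3 → Fin 3 → Fin K → ℤ) (ι : Fin 5 → Fin K)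
    (hinj : Function.Injective ι) (hmono : ∀ i j : Fin 5, i ≤ j → d (ι i) ≤ d (ι j)) {θ θ' : ℤ} (hθ : θ < θ')
    (P R : Equiv.Perm (Fin 3) × (Fin 3 → Fin 5)) (hP : IsDominant d v ε θ (P.1, ι ∘ P.2))
    (hR : IsDominant d v ε θ' (R.1, ι ∘ R.2)) (hdom : domB P R = true) : False := by
  classical
  unfold domB at hdom
  obtain ⟨T, -, hT⟩ := List.any_eq_true.mp hdom
  rw [Bool.and_eq_true, Bool.and_eq_true, decide_eq_true_eq, decide_eq_true_eq] at hT
  obtain ⟨⟨hinv, b₀, hb₀, hdiff⟩, hπ⟩ := hT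
  obtain ⟨π, -, hπ2⟩ := List.any_eq_true.mp hπ
  rw [Bool.and_eq_true, decide_eq_true_eq, decide_eq_true_eq] at hπ2
  obtain ⟨hπT, hle⟩ := hπ2
  set TF : Finset (Fin 3) := univ.filter fun b => T b = true with hTF
  have hmem : ∀ b, b ∈ TF ↔ T b = true := fun b => by rw [hTF, mem_filter]; simp
  -- the exchange law on `TF`
  have hlaw := sum_d_lt_of_isDominant_invariant d v ε hθ hP hR TF
    (fun b => by rw [hmem, hmem, hinv]) ⟨b₀, (hmem b₀).mpr hb₀, by
      rcases hdiff with h | h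
      · exact Or.inl h
      · exact Or.inr fun h' => h (hinj h')⟩
  -- domination
  have hdomle : ∑ b ∈ TF, (d ((ι ∘ R.2) b) : ℤ) ≤ ∑ b ∈ TF, (d ((ι ∘ P.2) (π b)) : ℤ) := by
    refine sum_le_sum fun b hb => ?_
    exact_mod_cast hmono _ _ (hle b ((hmem b).mp hb))
  have himg : TF.image π = TF := by
    refine Finset.eq_of_subset_of_card_le (fun x hx => ?_) ?_
    · obtain ⟨b, hb, rfl⟩ := mem_image.mp hx
      exact (hmem _).mpr (hπT b ((hmem b).mp hb))
    · rw [Finset.card_image_of_injective _ π.injective]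
  have hreidx : ∑ b ∈ TF, (d ((ι ∘ P.2) (π b)) : ℤ) = ∑ b ∈ TF, (d ((ι ∘ P.2) b) : ℤ) := by
    rw [← Finset.sum_image (f := fun x => (d ((ι ∘ P.2) x) : ℤ)) (fun x _ y _ h => π.injective h), himg]
  have h1 : ∑ b ∈ TF, (d ((ι ∘ P.2) b) : ℤ) < ∑ b ∈ TF, (d ((ι ∘ R.2) b) : ℤ) := hlaw
  linarith

/-! ## 2. The two cores by kernel evaluation -/

/-- arrangements of the class multiset `{0,0,4}`. -/
def arr004 : List (Fin 3 → Fin 5) := [![0, 0, 4], ![0, 4, 0], ![4, 0, 0]]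
/-- arrangements of `{0,2,2}`. -/
def arr022 : List (Fin 3 → Fin 5) := [![0, 2, 2], ![2, 0, 2], ![2, 2, 0]]
/-- arrangements of `{0,1,3}`. -/
def arr013 : List (Fin 3 → Fin 5) := [![0, 1, 3], ![0, 3, 1], ![1, 0, 3], ![1, 3, 0], ![3, 0, 1], ![3, 1, 0]]
/-- arrangements of `{1,1,1}`. -/
def arr111 : List (Fin 3 → Fin 5) := [![1, 1, 1]]
/-- arrangements of `{2,2,2}`. -/
def arr222 : List (Fin 3 → Fin 5) := [![2, 2, 2]]

set_option maxRecDepth 20000 in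
/-- every class vector with multiset `{0,0,4}` is listed. -/
theorem mem_arr004 (c : Fin 3 → Fin 5) (h : (univ.val.map c : Multiset (Fin 5)) = {0, 0, 4}) : c ∈ arr004 := by
  revert c; decide
set_option maxRecDepth 20000 in
/-- every class vector with multiset `{0,2,2}` is listed. -/
theorem mem_arr022 (c : Fin 3 → Fin 5) (h : (univ.val.map c : Multiset (Fin 5)) = {0, 2, 2}) : c ∈ arr022 := by
  revert c; decide
set_option maxRecDepth 20000 in
/-- every class vector with multiset `{0,1,3}` is listed. -/
theorem mem_arr013 (c : Fin 3 → Fin 5) (h : (univ.val.map c : Multiset (Fin 5)) = {0, 1, 3}) : c ∈ arr013 := by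
  revert c; decide
set_option maxRecDepth 20000 in
/-- every class vector with multiset `{1,1,1}` is listed. -/
theorem mem_arr111 (c : Fin 3 → Fin 5) (h : (univ.val.map c : Multiset (Fin 5)) = {1, 1, 1}) : c ∈ arr111 := by
  revert c; decide
set_option maxRecDepth 20000 in
/-- every class vector with multiset `{2,2,2}` is listed. -/
theorem mem_arr222 (c : Fin 3 → Fin 5) (h : (univ.val.map c : Multiset (Fin 5)) = {2, 2, 2}) : c ∈ arr222 := by
  revert c; decide

/-- the Boolean search for core U2: `004 < 022 < 013 < 111` (every branch hits a dominated pair). -/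
def coreU2 : Bool :=
  S3List.all fun σA => arr004.all fun cA =>
  S3List.all fun σD => arr111.all fun cD =>
    domB (σA, cA) (σD, cD) ||
    S3List.all fun σB => arr022.all fun cB =>
      (domB (σA, cA) (σB, cB) || domB (σB, cB) (σD, cD)) ||
      S3List.all fun σC => arr013.all fun cC =>
        domB (σA, cA) (σC, cC) || domB (σB, cB) (σC, cC) || domB (σC, cC) (σD, cD)

/-- the Boolean search for core U1: `111 < 022 < 222 < 013 < 004`. -/
def coreU1 : Bool :=
  S3List.all fun σA => arr111.all fun cA =>
  S3List.all fun σE => arr004.all fun cE =>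
    domB (σA, cA) (σE, cE) ||
    S3List.all fun σC => arr222.all fun cC =>
      (domB (σA, cA) (σC, cC) || domB (σC, cC) (σE, cE)) ||
      S3List.all fun σD => arr013.all fun cD =>
        (domB (σA, cA) (σD, cD) || domB (σC, cC) (σD, cD) || domB (σD, cD) (σE, cE)) ||
        S3List.all fun σB => arr022.all fun cB =>
          domB (σA, cA) (σB, cB) || domB (σB, cB) (σC, cC) || domB (σB, cB) (σD, cD) || domB (σB, cB) (σE, cE)

/-- kernel evaluation of the U2 search. -/
theorem coreU2_true : coreU2 = true := by
  decide

/-- kernel evaluation of the U1 search. -/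
theorem coreU1_true : coreU1 = true := by
  decide

/-! ## 3. The forbidden patterns -/

/-- **FORBIDDEN PATTERN U2** (`004 < 022 < 013 < 111`): in no design (exponents monotone along an injective class embedding `ι`) are
there unique optima at slopes `θA < θB < θC < θD` carrying the class multisets `{ι0,ι0,ι4}`, `{ι0,ι2,ι2}`, `{ι0,ι1,ι3}`, `{ι1,ι1,ι1}`
in this order. [this cell] -/
theorem no_pattern_U2 {K : ℕ} (d : Fin K → ℕ) (v ε : Fin 3 → Fin 3 → Fin K → ℤ) (ι : Fin 5 → Fin K)
    (hinj : Function.Injective ι) (hmono : ∀ i j : Fin 5, i ≤ j → d (ι i) ≤ d (ι j))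
    {θA θB θC θD : ℤ} (hAB : θA < θB) (hBC : θB < θC) (hCD : θC < θD)
    (A B C D : Equiv.Perm (Fin 3) × (Fin 3 → Fin 5))
    (hA : A.2 ∈ arr004) (hB : B.2 ∈ arr022) (hC : C.2 ∈ arr013) (hD : D.2 ∈ arr111)
    (hdA : IsDominant d v ε θA (A.1, ι ∘ A.2)) (hdB : IsDominant d v ε θB (B.1, ι ∘ B.2))
    (hdC : IsDominant d v ε θC (C.1, ι ∘ C.2)) (hdD : IsDominant d v ε θD (D.1, ι ∘ D.2)) : False := by
  have h := coreU2_true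
  unfold coreU2 at h
  simp only [List.all_eq_true] at h
  have hS := mem_S3List
  have h1 := h A.1 (hS _) A.2 hA D.1 (hS _) D.2 hD
  rcases Bool.or_eq_true_iff.mp h1 with hd | h1
  · exact domB_sound d v ε ι hinj hmono (hAB.trans (hBC.trans hCD)) A D hdA hdD hd
  simp only [List.all_eq_true] at h1
  have h2 := h1 B.1 (hS _) B.2 hB
  rcases Bool.or_eq_true_iff.mp h2 with h2a | h2
  · rcases Bool.or_eq_true_iff.mp h2a with hd | hd
    · exact domB_sound d v ε ι hinj hmono hAB A B hdA hdB hd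
    · exact domB_sound d v ε ι hinj hmono (hBC.trans hCD) B D hdB hdD hd
  simp only [List.all_eq_true] at h2
  have h3 := h2 C.1 (hS _) C.2 hC
  rcases Bool.or_eq_true_iff.mp h3 with h3a | hd
  · rcases Bool.or_eq_true_iff.mp h3a with hd | hd
    · exact domB_sound d v ε ι hinj hmono (hAB.trans hBC) A C hdA hdC hd
    · exact domB_sound d v ε ι hinj hmono hBC B C hdB hdC hd
  · exact domB_sound d v ε ι hinj hmono hCD C D hdC hdD hd

/-- **FORBIDDEN PATTERN U1** (`111 < 022 < 222 < 013 < 004`): in no design (exponents monotone along an injective class embedding `ι`)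
are there unique optima at slopes `θA < θB < θC < θD < θE` carrying `{ι1,ι1,ι1}`, `{ι0,ι2,ι2}`, `{ι2,ι2,ι2}`, `{ι0,ι1,ι3}`, `{ι0,ι0,ι4}`
in this order. [this cell] -/
theorem no_pattern_U1 {K : ℕ} (d : Fin K → ℕ) (v ε : Fin 3 → Fin 3 → Fin K → ℤ) (ι : Fin 5 → Fin K)
    (hinj : Function.Injective ι) (hmono : ∀ i j : Fin 5, i ≤ j → d (ι i) ≤ d (ι j))
    {θA θB θC θD θE : ℤ} (hAB : θA < θB) (hBC : θB < θC) (hCD : θC < θD) (hDE : θD < θE)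
    (A B C D E : Equiv.Perm (Fin 3) × (Fin 3 → Fin 5))
    (hA : A.2 ∈ arr111) (hB : B.2 ∈ arr022) (hC : C.2 ∈ arr222) (hD : D.2 ∈ arr013) (hE : E.2 ∈ arr004)
    (hdA : IsDominant d v ε θA (A.1, ι ∘ A.2)) (hdB : IsDominant d v ε θB (B.1, ι ∘ B.2))
    (hdC : IsDominant d v ε θC (C.1, ι ∘ C.2)) (hdD : IsDominant d v ε θD (D.1, ι ∘ D.2))
    (hdE : IsDominant d v ε θE (E.1, ι ∘ E.2)) : False := by
  have h := coreU1_true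
  unfold coreU1 at h
  simp only [List.all_eq_true] at h
  have hS := mem_S3List
  have hAC := hAB.trans hBC
  have hAD := hAC.trans hCD
  have hAE := hAD.trans hDE
  have hBD := hBC.trans hCD
  have hBE := hBD.trans hDE
  have hCE := hCD.trans hDE
  have h1 := h A.1 (hS _) A.2 hA E.1 (hS _) E.2 hE
  rcases Bool.or_eq_true_iff.mp h1 with hd | h1
  · exact domB_sound d v ε ι hinj hmono hAE A E hdA hdE hd
  simp only [List.all_eq_true] at h1
  have h2 := h1 C.1 (hS _) C.2 hC
  rcases Bool.or_eq_true_iff.mp h2 with h2a | h2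
  · rcases Bool.or_eq_true_iff.mp h2a with hd | hd
    · exact domB_sound d v ε ι hinj hmono hAC A C hdA hdC hd
    · exact domB_sound d v ε ι hinj hmono hCE C E hdC hdE hd
  simp only [List.all_eq_true] at h2
  have h3 := h2 D.1 (hS _) D.2 hD
  rcases Bool.or_eq_true_iff.mp h3 with h3a | h3
  · rcases Bool.or_eq_true_iff.mp h3a with h3b | hd
    · rcases Bool.or_eq_true_iff.mp h3b with hd | hd
      · exact domB_sound d v ε ι hinj hmono hAD A D hdA hdD hd
      · exact domB_sound d v ε ι hinj hmono hCD C D hdC hdD hd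
    · exact domB_sound d v ε ι hinj hmono hDE D E hdD hdE hd
  simp only [List.all_eq_true] at h3
  have h4 := h3 B.1 (hS _) B.2 hB
  rcases Bool.or_eq_true_iff.mp h4 with h4a | hd
  · rcases Bool.or_eq_true_iff.mp h4a with h4b | hd
    · rcases Bool.or_eq_true_iff.mp h4b with hd | hd
      · exact domB_sound d v ε ι hinj hmono hAB A B hdA hdB hd
      · exact domB_sound d v ε ι hinj hmono hBC B C hdB hdC hd
    · exact domB_sound d v ε ι hinj hmono hBD B D hdB hdD hd
  · exact domB_sound d v ε ι hinj hmono hBE B E hdB hdE hd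

/-! ## 4. The `(3,5)` row is not counting-tight on the convex and the concave exponent regions -/

/-- A sign-alternating dominant chain of a `(3,5)` design carries pairwise distinct class multisets; so if it has `n ≥ 34` sign changes,
every class multiset occurs: for each `s : Sym (Fin 5) 3` some chain position carries it. -/
theorem exists_pos_of_ge {d : Fin 5 → ℕ} {v ε : Fin 3 → Fin 3 → Fin 5 → ℤ} {n : ℕ} {θ : Fin (n + 1) → ℤ}
    {p : Fin (n + 1) → Equiv.Perm (Fin 3) × (Fin 3 → Fin 5)} (hθ : StrictMono θ)
    (hdom : ∀ k, IsDominant d v ε (θ k) (p k))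
    (halt : ∀ k : Fin n, termSign ε (p k.castSucc) * termSign ε (p k.succ) < 0) (hn : 34 ≤ n) :
    (StrictMono fun k => slope d (p k)) ∧ ∀ s : Sym (Fin 5) 3, ∃ k, classSym (p k) = s := by
  have hne : ∀ k : Fin n, p k.castSucc ≠ p k.succ := by
    intro k h
    have := halt k
    rw [h] at this
    exact absurd this (not_lt.mpr (mul_self_nonneg _))
  have hsm : StrictMono fun k => slope d (p k) := by
    rw [Fin.strictMono_iff_lt_succ]
    intro k
    exact slope_lt_of_dominant d v ε (hθ Fin.castSucc_lt_succ) (hne k) (hdom _) (hdom _)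
  have hinj : Function.Injective fun k => classSym (p k) := by
    intro k k' h
    apply hsm.injective
    simp only
    rw [slope_eq_of_classSym, slope_eq_of_classSym]
    exact congrArg (fun M : Sym (Fin 5) 3 => ((M : Multiset (Fin 5)).map fun l => (d l : ℤ)).sum) h
  have hcard : Fintype.card (Sym (Fin 5) 3) = 35 := by
    rw [Sym.card_sym_eq_multichoose, Fintype.card_fin, Nat.multichoose_eq]
    decide
  have hbij : Function.Bijective fun k => classSym (p k) := by
    rw [Fintype.bijective_iff_injective_and_card]
    refine ⟨hinj, ?_⟩
    have hle := Fintype.card_le_of_injective _ hinj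
    rw [Fintype.card_fin] at hle ⊢
    omega
  exact ⟨hsm, hbij.2⟩

/-- the slope of a term from its class multiset, for the four / five pattern multisets. -/
theorem slope_of_classSym_eq (d : Fin 5 → ℕ) (p : Equiv.Perm (Fin 3) × (Fin 3 → Fin 5)) (a b c : Fin 5)
    (h : classSym p = (⟨{a, b, c}, by simp⟩ : Sym (Fin 5) 3)) : slope d p = (d a : ℤ) + d b + d c := by
  rw [slope_eq_of_classSym, h]
  simp [add_assoc]

/-- **`T(3,5) ≤ 33` ON THE CONCAVE REGION** `2d₀+d₄ < d₀+2d₂ < d₀+d₁+d₃ < 3d₁` (strictly increasing `d`): every sign-alternating dominant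
chain of a `(3,5)` design with such exponents has at most `33` sign changes (slope counting gives `34`). [this cell] -/
theorem three_five_le_of_concave (d : Fin 5 → ℕ) (hd : StrictMono d)
    (h1 : 2 * d 0 + d 4 < d 0 + 2 * d 2) (h2 : d 0 + 2 * d 2 < d 0 + d 1 + d 3) (h3 : d 0 + d 1 + d 3 < 3 * d 1)
    (v ε : Fin 3 → Fin 3 → Fin 5 → ℤ) (n : ℕ) (θ : Fin (n + 1) → ℤ)
    (p : Fin (n + 1) → Equiv.Perm (Fin 3) × (Fin 3 → Fin 5)) (hθ : StrictMono θ)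
    (hdom : ∀ k, IsDominant d v ε (θ k) (p k))
    (halt : ∀ k : Fin n, termSign ε (p k.castSucc) * termSign ε (p k.succ) < 0) : n ≤ 33 := by
  by_contra hn
  push Not at hn
  obtain ⟨hsm, hsurj⟩ := exists_pos_of_ge hθ hdom halt (by omega)
  obtain ⟨kA, hkA⟩ := hsurj ⟨{0, 0, 4}, by simp⟩
  obtain ⟨kB, hkB⟩ := hsurj ⟨{0, 2, 2}, by simp⟩
  obtain ⟨kC, hkC⟩ := hsurj ⟨{0, 1, 3}, by simp⟩
  obtain ⟨kD, hkD⟩ := hsurj ⟨{1, 1, 1}, by simp⟩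
  have sA := slope_of_classSym_eq d (p kA) 0 0 4 hkA
  have sB := slope_of_classSym_eq d (p kB) 0 2 2 hkB
  have sC := slope_of_classSym_eq d (p kC) 0 1 3 hkC
  have sD := slope_of_classSym_eq d (p kD) 1 1 1 hkD
  have h1' : (2 * d 0 + d 4 : ℤ) < d 0 + 2 * d 2 := by exact_mod_cast h1
  have h2' : (d 0 + 2 * d 2 : ℤ) < d 0 + d 1 + d 3 := by exact_mod_cast h2
  have h3' : (d 0 + d 1 + d 3 : ℤ) < 3 * d 1 := by exact_mod_cast h3
  have hAB : kA < kB := hsm.lt_iff_lt.mp (by simp only [sA, sB]; linarith)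
  have hBC : kB < kC := hsm.lt_iff_lt.mp (by simp only [sB, sC]; linarith)
  have hCD : kC < kD := hsm.lt_iff_lt.mp (by simp only [sC, sD]; linarith)
  have hA : (p kA).2 ∈ arr004 := mem_arr004 _ (by simpa [classSym] using congrArg (fun s : Sym (Fin 5) 3 => (s : Multiset (Fin 5))) hkA)
  have hB : (p kB).2 ∈ arr022 := mem_arr022 _ (by simpa [classSym] using congrArg (fun s : Sym (Fin 5) 3 => (s : Multiset (Fin 5))) hkB)
  have hC : (p kC).2 ∈ arr013 := mem_arr013 _ (by simpa [classSym] using congrArg (fun s : Sym (Fin 5) 3 => (s : Multiset (Fin 5))) hkC)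
  have hD : (p kD).2 ∈ arr111 := mem_arr111 _ (by simpa [classSym] using congrArg (fun s : Sym (Fin 5) 3 => (s : Multiset (Fin 5))) hkD)
  exact no_pattern_U2 d v ε id (fun a b h => h) (fun i j hij => hd.monotone hij) (hθ hAB) (hθ hBC) (hθ hCD)
    (p kA) (p kB) (p kC) (p kD) hA hB hC hD (hdom kA) (hdom kB) (hdom kC) (hdom kD)

/-- **`T(3,5) ≤ 33` ON THE CONVEX REGION** `3d₁ < d₀+2d₂`, `3d₂ < d₀+d₁+d₃`, `d₀+d₁+d₃ < 2d₀+d₄` (strictly increasing `d`; this contains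
every super-increasing / lexicographic `(3,5)` design): every sign-alternating dominant chain has at most `33` sign changes. [this cell] -/
theorem three_five_le_of_convex (d : Fin 5 → ℕ) (hd : StrictMono d)
    (h1 : 3 * d 1 < d 0 + 2 * d 2) (h2 : 3 * d 2 < d 0 + d 1 + d 3) (h3 : d 0 + d 1 + d 3 < 2 * d 0 + d 4)
    (v ε : Fin 3 → Fin 3 → Fin 5 → ℤ) (n : ℕ) (θ : Fin (n + 1) → ℤ)
    (p : Fin (n + 1) → Equiv.Perm (Fin 3) × (Fin 3 → Fin 5)) (hθ : StrictMono θ)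
    (hdom : ∀ k, IsDominant d v ε (θ k) (p k))
    (halt : ∀ k : Fin n, termSign ε (p k.castSucc) * termSign ε (p k.succ) < 0) : n ≤ 33 := by
  by_contra hn
  push Not at hn
  obtain ⟨hsm, hsurj⟩ := exists_pos_of_ge hθ hdom halt (by omega)
  obtain ⟨kA, hkA⟩ := hsurj ⟨{1, 1, 1}, by simp⟩
  obtain ⟨kB, hkB⟩ := hsurj ⟨{0, 2, 2}, by simp⟩
  obtain ⟨kC, hkC⟩ := hsurj ⟨{2, 2, 2}, by simp⟩
  obtain ⟨kD, hkD⟩ := hsurj ⟨{0, 1, 3}, by simp⟩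
  obtain ⟨kE, hkE⟩ := hsurj ⟨{0, 0, 4}, by simp⟩
  have sA := slope_of_classSym_eq d (p kA) 1 1 1 hkA
  have sB := slope_of_classSym_eq d (p kB) 0 2 2 hkB
  have sC := slope_of_classSym_eq d (p kC) 2 2 2 hkC
  have sD := slope_of_classSym_eq d (p kD) 0 1 3 hkD
  have sE := slope_of_classSym_eq d (p kE) 0 0 4 hkE
  have h02 : (d 0 : ℤ) < d 2 := by exact_mod_cast hd (by decide : (0 : Fin 5) < 2)
  have h1' : (3 * d 1 : ℤ) < d 0 + 2 * d 2 := by exact_mod_cast h1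
  have h2' : (3 * d 2 : ℤ) < d 0 + d 1 + d 3 := by exact_mod_cast h2
  have h3' : (d 0 + d 1 + d 3 : ℤ) < 2 * d 0 + d 4 := by exact_mod_cast h3
  have hAB : kA < kB := hsm.lt_iff_lt.mp (by simp only [sA, sB]; linarith)
  have hBC : kB < kC := hsm.lt_iff_lt.mp (by simp only [sB, sC]; linarith)
  have hCD : kC < kD := hsm.lt_iff_lt.mp (by simp only [sC, sD]; linarith)
  have hDE : kD < kE := hsm.lt_iff_lt.mp (by simp only [sD, sE]; linarith)
  have hA : (p kA).2 ∈ arr111 := mem_arr111 _ (by simpa [classSym] using congrArg (fun s : Sym (Fin 5) 3 => (s : Multiset (Fin 5))) hkA)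
  have hB : (p kB).2 ∈ arr022 := mem_arr022 _ (by simpa [classSym] using congrArg (fun s : Sym (Fin 5) 3 => (s : Multiset (Fin 5))) hkB)
  have hC : (p kC).2 ∈ arr222 := mem_arr222 _ (by simpa [classSym] using congrArg (fun s : Sym (Fin 5) 3 => (s : Multiset (Fin 5))) hkC)
  have hD : (p kD).2 ∈ arr013 := mem_arr013 _ (by simpa [classSym] using congrArg (fun s : Sym (Fin 5) 3 => (s : Multiset (Fin 5))) hkD)
  have hE : (p kE).2 ∈ arr004 := mem_arr004 _ (by simpa [classSym] using congrArg (fun s : Sym (Fin 5) 3 => (s : Multiset (Fin 5))) hkE)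
  exact no_pattern_U1 d v ε id (fun a b h => h) (fun i j hij => hd.monotone hij) (hθ hAB) (hθ hBC) (hθ hCD) (hθ hDE)
    (p kA) (p kB) (p kC) (p kD) (p kE) hA hB hC hD hE (hdom kA) (hdom kB) (hdom kC) (hdom kD) (hdom kE)

end ForbiddenPatterns

end Summit.ValiantsHypothesis.ValiantsHypothesis.Theorems.KPlusLogSqLaw
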